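import Summits.QuantumFields.BalabanUV.Beta.FP.SliceProjectorDiffSymbol

/-!
# `BalabanUV.Beta.FP.SliceProjectorKernelDiff` — road «FP» (binder row D1), organisation γ, row GAMMA-3 «DIFFERENCE LETTERS OF `(1−Π)_N`» part 3∕3 (END):
# **`(1 − Π)_N` IS A SMOOTH LEG AT SCALE `N` TO FIRST ORDER IN EACH VARIABLE** — one fine difference in the column variable, in the row variable, and
# one in each (mixed) cost exactly `N^{−1}`, `N^{−1}`, `N^{−2}` on top of the zeroth letter `CS(D)·N^{−D}·e^{−κ_Y‖blk x − blk y‖∞}`, n-UNIFORMLY and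
# WITHOUT logarithm — the `B·n^{−2−j}` letter shape (`D = 4`: `n⁻⁴`, `n⁻⁵`, `n⁻⁶`) that `SliceLoopPairing` ∕ the (pp)–(rem) pieces take for a `(1−Π)`-dressed leg

HONEST FRAMING (cell contract, verbatim): «discharging `BetaPertH` makes Bałaban's UV stability UNCONDITIONAL — a real constructive-QFT
result; it is NOT the continuum limit and NOT the Clay problem.»  HONEST DEPENDENCY (verbatim): «continuum YM on T⁴ ⇐ BetaPertH ∧ nine
spine estimates (0/9 proved); BetaPertH ⇐ (D1) ∧ (D4) ∧ CAP+tail; G-an2-4 gates asym, D1 and NE2/3/4.»  THIS MODULE DISCHARGES NOTHING of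
D1 ∕ BetaPertH: [folklore] the chart readings of `FP/SliceProjectorKernel.piC` ✓ (`piC_chart`), linearity of `latticeKernel` for strip-regular symbols,
parts 1–2, and `B4ContourShift.latticeKernel_decay` ✓ BY NAME; no `def`, no `def … : Prop`; nothing is cited; 0 sorry.  NOT HERE (declared, NOT claimed):
the PURE second difference in ONE variable (log-lossy: `Δ⁻¹` of block-constant data is `C^{1,α}`, not `C²`), B-jets, the torus reading.  NOT summit progress;
NOT hbook, NOT D1, NOT BetaPertH, NOT continuum, NOT Clay.

ABSOLUTE RULE (cell, verbatim): «No internally-minted statement may enter as a cited fact. Every hypothesis is either kernel-proved in this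
package or a verbatim quotation of a PUBLISHED theorem with page reference. The manuscript(s) under audit are NOT citable for their own
disputed steps — they are the thing under adjudication; programme-internal (2001/route/tribunal) claims are never citable.»

CONTENT (`D = d+1`, `N ≥ 1`, `e_μ = AffineAveraging.unitVec μ`, `blk = SliceProjectorBlochChart.blkN N`):
* `latticeKernel_sub_of_stripRegular`; **`piC_chart_sub_right`** (`piC N (N•X + (a+e_μ)) (N•Y+b) − piC N (N•X+a) (N•Y+b) = N^{−D}·latticeKernel (SDx N μ (−b) (−a)) (X−Y)`),
  **`piC_chart_sub_left`**, **`piC_chart_sub_sub`**; `abs_neg_loc_le`;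
* THE LETTERS: **`norm_piC_sub_right_le`** (`‖piC N (x+e_μ) y − piC N x y‖ ≤ CS(D)·N^{−D}·(33∕N)·e^{−κ_Y‖blk x − blk y‖∞}`), **`norm_piC_sub_left_le`**
  (the same for `y + e_ν`), **`norm_piC_sub_sub_le`** (mixed: `≤ CS(D)·N^{−D}·(33∕N)²·e^{−κ_Y‖blk x − blk y‖∞}`); and in FINE-DISTANCE currency
  (`exp_blk_le_exp_fine`): `norm_piC_sub_right_le_fine`, `norm_piC_sub_left_le_fine`, `norm_piC_sub_sub_le_fine` (`·e^{κ_Y}·e^{−(κ_Y∕N)‖x−y‖∞}`).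
Unit `b2b-balaban-beta-d1-formalise-leaf-06` (gen 9), road «FP» OWNER GO R-FP-35 (e) journal l.27818 on INTENT l.27787 (offer O1 of l.27658); organisation γ (R-FP-25), row GAMMA-3 (in flight), under R-FP-33 (b)(c).
-/

noncomputable section

namespace Summit.QuantumFields.BalabanUV.Beta.FP.SliceProjectorKernelDiff

open Complex Finset MeasureTheory
open scoped BigOperators Real
open Literature.MathematicalPhysics.QuantumFieldTheory.Balaban1983to89
open Literature.MathematicalPhysics.QuantumFieldTheory.Balaban1983to89.Beta.AffineAveraging (unitVec unitVec_apply)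
open B4Strip (Strip ofRealVec DeltaXi shift U)
open B4StripCauchy (Fat rOf rOf_le rOf_pos strip_subset_fat norm_DeltaXi_le norm_DeltaXi_shift_ge d_mul_rOf_sq_le)
open B5Strip145 (Ncal)
open B4ContourShift (BZ phase integrand fourierBox latticeKernel StripRegular supNorm latticeKernel_decay ofRealVec_mem_Strip)
open B4Green244 (latticeKernel_congr)
open Beta.FibreInverseDecay (cphase)
open Summit.QuantumFields.BalabanUV.Beta.GAN24.FibreSymbols (gsum pw pw_add pw_add_unitVec pw_sub_unitVec)
open Summit.QuantumFields.BalabanUV.Beta.GAN24.AliasDecimate (aliasPt)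
open Summit.QuantumFields.BalabanUV.Beta.GAN24.AliasStripSymbols (norm_cexp_I_mul_sub_one_le')
open Summit.QuantumFields.BalabanUV.Beta.FP.CoarseCovarianceStripAliasWeights (aliasPt_apply' aliasPt_im)
open Summit.QuantumFields.BalabanUV.Beta.FP.SliceProjectorMidInv (kapY kapY_pos kapY_le_rOf Ncal_lower)
open Summit.QuantumFields.BalabanUV.Beta.FP.SliceProjectorEntries (qa qb ew Aent ew_zero ew_ne qa_mul_qb strip_facts)
open Summit.QuantumFields.BalabanUV.Beta.FP.SliceProjectorSymbol (S)
open Summit.QuantumFields.BalabanUV.Beta.FP.SliceProjectorAliasIndex (jt one_le_jt jt_pos jt_of_val_zero jt_eq_or c1 c1_pos fat_facts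
  aliasPt_re_half aliasPt_im_mul norm_qa_le_prod norm_qb_le_prod)
open Summit.QuantumFields.BalabanUV.Beta.FP.SliceProjectorAliasSum (jt_sq_le_norm_DeltaXi_shift eD eD_pos eD_le_one eD_mul prod_jt_rpow_le
  wt wt_nonneg prod_wt_eq Cqe Cqe_nonneg sum_wt_le sum_prod_wt_eq sum_norm_qa_mul_ew_le sum_norm_qb_mul_ew_le l1 l1_neg norm_cphase_le
  cN cN_pos MS CS exp_offset_le norm_Aent_eq stripRegular_S MS_le_CS)
open Summit.QuantumFields.BalabanUV.Beta.FP.SliceProjectorBlochChart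
open Summit.QuantumFields.BalabanUV.Beta.FP.SliceProjectorBloch
open Summit.QuantumFields.BalabanUV.Beta.FP.SliceProjectorKernel
open Summit.QuantumFields.BalabanUV.Beta.FP.SliceProjectorKernelLaplace (cphase_add_unitVec cphase_sub_unitVec)
open Summit.QuantumFields.BalabanUV.Beta.FP.SliceProjectorDiffChord
open Summit.QuantumFields.BalabanUV.Beta.FP.SliceProjectorDiffSymbol

variable {d : ℕ}

/-! ## §4 THE LETTERS: one difference per variable costs one power of `N` -/

section Letters

variable (N : ℕ) [NeZero N]

/-- [folklore] linearity of the lattice kernel for two strip-regular symbols (difference form). -/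
theorem latticeKernel_sub_of_stripRegular {G₁ G₂ : (Fin (d + 1) → ℂ) → ℂ} {κ M₁ M₂ : ℝ} (h₁ : StripRegular G₁ κ M₁) (h₂ : StripRegular G₂ κ M₂)
    (hκ : 0 ≤ κ) (X : Fin (d + 1) → ℤ) : latticeKernel G₁ X - latticeKernel G₂ X = latticeKernel (fun p => G₁ p - G₂ p) X := by
  unfold latticeKernel fourierBox
  rw [← smul_sub, ← integral_sub (h₁.integrableOn hκ X) (h₂.integrableOn hκ X)]
  congr 1
  refine setIntegral_congr_fun measurableSet_Icc fun p _ => ?_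
  simp only [integrand, sub_mul]

/-- [our object] **THE COLUMN DIFFERENCE IN CHART FORM**:
`piC N (N•X + (a + e_μ)) (N•Y + b) − piC N (N•X + a) (N•Y + b) = N^{−D}·latticeKernel (SDx N μ (−b) (−a)) (X − Y)`. -/
theorem piC_chart_sub_right (X a Y b : Fin (d + 1) → ℤ) (μ : Fin (d + 1)) :
    piC N ((N : ℤ) • X + (a + unitVec μ)) ((N : ℤ) • Y + b) - piC N ((N : ℤ) • X + a) ((N : ℤ) • Y + b)
      = (((N : ℂ) ^ (d + 1))⁻¹) * latticeKernel (SDx N μ (-b) (-a)) (X - Y) := by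
  have hκ := (kapY_pos (d + 1)).le
  rw [piC_chart, piC_chart, ← mul_sub, neg_add', latticeKernel_sub_of_stripRegular (stripRegular_S N (-b) (-a - unitVec μ))
    (stripRegular_S N (-b) (-a)) hκ]
  congr 2
  exact funext fun p => S_sub_right N μ (-b) (-a) p

/-- [our object] **THE ROW DIFFERENCE IN CHART FORM**:
`piC N (N•X + a) (N•Y + (b + e_ν)) − piC N (N•X + a) (N•Y + b) = N^{−D}·latticeKernel (SDy N ν (−b) (−a)) (X − Y)`. -/
theorem piC_chart_sub_left (X a Y b : Fin (d + 1) → ℤ) (ν : Fin (d + 1)) :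
    piC N ((N : ℤ) • X + a) ((N : ℤ) • Y + (b + unitVec ν)) - piC N ((N : ℤ) • X + a) ((N : ℤ) • Y + b)
      = (((N : ℂ) ^ (d + 1))⁻¹) * latticeKernel (SDy N ν (-b) (-a)) (X - Y) := by
  have hκ := (kapY_pos (d + 1)).le
  rw [piC_chart, piC_chart, ← mul_sub, neg_add', latticeKernel_sub_of_stripRegular (stripRegular_S N (-b - unitVec ν) (-a))
    (stripRegular_S N (-b) (-a)) hκ]
  congr 2
  exact funext fun p => S_sub_left N ν (-b) (-a) p

/-- [our object] **THE MIXED SECOND DIFFERENCE IN CHART FORM** (one unit step in each variable). -/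
theorem piC_chart_sub_sub (X a Y b : Fin (d + 1) → ℤ) (μ ν : Fin (d + 1)) :
    piC N ((N : ℤ) • X + (a + unitVec μ)) ((N : ℤ) • Y + (b + unitVec ν)) - piC N ((N : ℤ) • X + (a + unitVec μ)) ((N : ℤ) • Y + b)
      - piC N ((N : ℤ) • X + a) ((N : ℤ) • Y + (b + unitVec ν)) + piC N ((N : ℤ) • X + a) ((N : ℤ) • Y + b)
      = (((N : ℂ) ^ (d + 1))⁻¹) * latticeKernel (SDxy N μ ν (-b) (-a)) (X - Y) := by
  have hκ := (kapY_pos (d + 1)).le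
  rw [piC_chart, piC_chart, piC_chart, piC_chart, neg_add', neg_add']
  set C : ℂ := ((N : ℂ) ^ (d + 1))⁻¹
  have h1 := latticeKernel_sub_of_stripRegular (stripRegular_S N (-b - unitVec ν) (-a - unitVec μ)) (stripRegular_S N (-b - unitVec ν) (-a)) hκ (X - Y)
  have h2 := latticeKernel_sub_of_stripRegular (stripRegular_S N (-b) (-a - unitVec μ)) (stripRegular_S N (-b) (-a)) hκ (X - Y)
  have hG1 := stripRegular_sub_of_bound (stripRegular_S N (-b - unitVec ν) (-a - unitVec μ)) (stripRegular_S N (-b - unitVec ν) (-a))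
    (M := MS d N (-b - unitVec ν) (-a - unitVec μ) + MS d N (-b - unitVec ν) (-a))
    (fun p hp => (norm_sub_le _ _).trans (add_le_add ((stripRegular_S N (-b - unitVec ν) (-a - unitVec μ)).bound p hp)
      ((stripRegular_S N (-b - unitVec ν) (-a)).bound p hp)))
  have hG2 := stripRegular_sub_of_bound (stripRegular_S N (-b) (-a - unitVec μ)) (stripRegular_S N (-b) (-a))
    (M := MS d N (-b) (-a - unitVec μ) + MS d N (-b) (-a))
    (fun p hp => (norm_sub_le _ _).trans (add_le_add ((stripRegular_S N (-b) (-a - unitVec μ)).bound p hp) ((stripRegular_S N (-b) (-a)).bound p hp)))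
  have h3 := latticeKernel_sub_of_stripRegular hG1 hG2 hκ (X - Y)
  have hfun : (fun p => (S N (-b - unitVec ν) (-a - unitVec μ) p - S N (-b - unitVec ν) (-a) p) - (S N (-b) (-a - unitVec μ) p - S N (-b) (-a) p))
      = SDxy N μ ν (-b) (-a) := funext fun p => by rw [← S_sub_sub]; ring
  rw [hfun] at h3
  rw [← h3, ← h1, ← h2]
  ring

/-- [folklore] the offsets of the canonical chart are at most `N` in absolute value (negated). -/
theorem abs_neg_loc_le (x : Fin (d + 1) → ℤ) (μ : Fin (d + 1)) : |(-(finSite N (locN N x))) μ| ≤ N := abs_neg_finSite_le N (locN N x) μ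

/-- [our object] **THE COLUMN-DIFFERENCE LETTER**: `‖piC N (x + e_μ) y − piC N x y‖ ≤ CS(D)·N^{−D}·(33∕N)·e^{−κ_Y‖blk x − blk y‖∞}` — one
fine difference in the column variable costs exactly one power of `N`, n-UNIFORMLY (no logarithm). -/
theorem norm_piC_sub_right_le (x y : Fin (d + 1) → ℤ) (μ : Fin (d + 1)) :
    ‖piC N (x + unitVec μ) y - piC N x y‖
      ≤ CS d * ((N : ℝ) ^ (d + 1))⁻¹ * (33 / N) * Real.exp (-(kapY (d + 1) * supNorm (blkN N x - blkN N y))) := by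
  have hκ := kapY_pos (d + 1)
  have h := piC_chart_sub_right N (blkN N x) (finSite N (locN N x)) (blkN N y) (finSite N (locN N y)) μ
  rw [← add_assoc, chart_blkN_locN, chart_blkN_locN] at h
  rw [h, norm_mul, norm_inv, norm_pow, Complex.norm_natCast]
  have hdec := latticeKernel_decay (stripRegular_SD N μ μ (-finSite N (locN N y)) (-finSite N (locN N x))).1 hκ.le (blkN N x - blkN N y)
  have hMS := MS_le_CS N (abs_neg_loc_le N y) (abs_neg_loc_le N x)
  have hn : (0 : ℝ) < N := by exact_mod_cast Nat.pos_of_ne_zero (NeZero.ne N)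
  calc ((N : ℝ) ^ (d + 1))⁻¹ * ‖latticeKernel (SDx N μ (-finSite N (locN N y)) (-finSite N (locN N x))) (blkN N x - blkN N y)‖
      ≤ ((N : ℝ) ^ (d + 1))⁻¹ * (33 * MS d N (-finSite N (locN N y)) (-finSite N (locN N x)) / N
          * Real.exp (-(kapY (d + 1) * supNorm (blkN N x - blkN N y)))) := mul_le_mul_of_nonneg_left hdec (by positivity)
    _ ≤ ((N : ℝ) ^ (d + 1))⁻¹ * (33 * CS d / N * Real.exp (-(kapY (d + 1) * supNorm (blkN N x - blkN N y)))) := by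
        refine mul_le_mul_of_nonneg_left (mul_le_mul_of_nonneg_right ?_ (Real.exp_pos _).le) (by positivity)
        exact div_le_div_of_nonneg_right (by linarith) hn.le
    _ = _ := by ring

/-- [our object] **THE ROW-DIFFERENCE LETTER**: `‖piC N x (y + e_ν) − piC N x y‖ ≤ CS(D)·N^{−D}·(33∕N)·e^{−κ_Y‖blk x − blk y‖∞}`. -/
theorem norm_piC_sub_left_le (x y : Fin (d + 1) → ℤ) (ν : Fin (d + 1)) :
    ‖piC N x (y + unitVec ν) - piC N x y‖
      ≤ CS d * ((N : ℝ) ^ (d + 1))⁻¹ * (33 / N) * Real.exp (-(kapY (d + 1) * supNorm (blkN N x - blkN N y))) := by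
  have hκ := kapY_pos (d + 1)
  have h := piC_chart_sub_left N (blkN N x) (finSite N (locN N x)) (blkN N y) (finSite N (locN N y)) ν
  rw [← add_assoc, chart_blkN_locN, chart_blkN_locN] at h
  rw [h, norm_mul, norm_inv, norm_pow, Complex.norm_natCast]
  have hdec := latticeKernel_decay (stripRegular_SD N ν ν (-finSite N (locN N y)) (-finSite N (locN N x))).2.1 hκ.le (blkN N x - blkN N y)
  have hMS := MS_le_CS N (abs_neg_loc_le N y) (abs_neg_loc_le N x)
  have hn : (0 : ℝ) < N := by exact_mod_cast Nat.pos_of_ne_zero (NeZero.ne N)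
  calc ((N : ℝ) ^ (d + 1))⁻¹ * ‖latticeKernel (SDy N ν (-finSite N (locN N y)) (-finSite N (locN N x))) (blkN N x - blkN N y)‖
      ≤ ((N : ℝ) ^ (d + 1))⁻¹ * (33 * MS d N (-finSite N (locN N y)) (-finSite N (locN N x)) / N
          * Real.exp (-(kapY (d + 1) * supNorm (blkN N x - blkN N y)))) := mul_le_mul_of_nonneg_left hdec (by positivity)
    _ ≤ ((N : ℝ) ^ (d + 1))⁻¹ * (33 * CS d / N * Real.exp (-(kapY (d + 1) * supNorm (blkN N x - blkN N y)))) := by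
        refine mul_le_mul_of_nonneg_left (mul_le_mul_of_nonneg_right ?_ (Real.exp_pos _).le) (by positivity)
        exact div_le_div_of_nonneg_right (by linarith) hn.le
    _ = _ := by ring

/-- [our object] **THE MIXED SECOND-DIFFERENCE LETTER** (one unit step in EACH variable):
`‖piC N (x+e_μ) (y+e_ν) − piC N (x+e_μ) y − piC N x (y+e_ν) + piC N x y‖ ≤ CS(D)·N^{−D}·(33∕N)²·e^{−κ_Y‖blk x − blk y‖∞}`. -/
theorem norm_piC_sub_sub_le (x y : Fin (d + 1) → ℤ) (μ ν : Fin (d + 1)) :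
    ‖piC N (x + unitVec μ) (y + unitVec ν) - piC N (x + unitVec μ) y - piC N x (y + unitVec ν) + piC N x y‖
      ≤ CS d * ((N : ℝ) ^ (d + 1))⁻¹ * (33 / N) ^ 2 * Real.exp (-(kapY (d + 1) * supNorm (blkN N x - blkN N y))) := by
  have hκ := kapY_pos (d + 1)
  have h := piC_chart_sub_sub N (blkN N x) (finSite N (locN N x)) (blkN N y) (finSite N (locN N y)) μ ν
  rw [← add_assoc, ← add_assoc, chart_blkN_locN, chart_blkN_locN] at h
  rw [h, norm_mul, norm_inv, norm_pow, Complex.norm_natCast]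
  have hdec := latticeKernel_decay (stripRegular_SD N μ ν (-finSite N (locN N y)) (-finSite N (locN N x))).2.2 hκ.le (blkN N x - blkN N y)
  have hMS := MS_le_CS N (abs_neg_loc_le N y) (abs_neg_loc_le N x)
  have hn : (0 : ℝ) < N := by exact_mod_cast Nat.pos_of_ne_zero (NeZero.ne N)
  calc ((N : ℝ) ^ (d + 1))⁻¹ * ‖latticeKernel (SDxy N μ ν (-finSite N (locN N y)) (-finSite N (locN N x))) (blkN N x - blkN N y)‖
      ≤ ((N : ℝ) ^ (d + 1))⁻¹ * (33 * 33 * MS d N (-finSite N (locN N y)) (-finSite N (locN N x)) / ((N : ℝ) * N)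
          * Real.exp (-(kapY (d + 1) * supNorm (blkN N x - blkN N y)))) := mul_le_mul_of_nonneg_left hdec (by positivity)
    _ ≤ ((N : ℝ) ^ (d + 1))⁻¹ * (33 * 33 * CS d / ((N : ℝ) * N) * Real.exp (-(kapY (d + 1) * supNorm (blkN N x - blkN N y)))) := by
        refine mul_le_mul_of_nonneg_left (mul_le_mul_of_nonneg_right ?_ (Real.exp_pos _).le) (by positivity)
        exact div_le_div_of_nonneg_right (by nlinarith) (by positivity)
    _ = _ := by field_simp

/-- [folklore] **BLOCK DISTANCE TO FINE DISTANCE** in the exponential: `e^{−κ‖blk x − blk y‖∞} ≤ e^{κ}·e^{−(κ∕N)‖x − y‖∞}` (`κ ≥ 0`, `N ≥ 1`;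
`‖x−y‖∞ ≤ N‖blk x − blk y‖∞ + (N−1)`, `SliceProjectorKernel.supNorm_sub_le_blkN`). -/
theorem exp_blk_le_exp_fine {κ : ℝ} (hκ : 0 ≤ κ) (x y : Fin (d + 1) → ℤ) :
    Real.exp (-(κ * supNorm (blkN N x - blkN N y))) ≤ Real.exp κ * Real.exp (-(κ / N) * supNorm (x - y)) := by
  have hN1 : (1 : ℝ) ≤ N := by exact_mod_cast Nat.one_le_iff_ne_zero.mpr (NeZero.ne N)
  have hN0 : (0 : ℝ) < N := by linarith
  have hs := supNorm_sub_le_blkN N x y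
  rw [← Real.exp_add]
  apply Real.exp_le_exp.mpr
  have h1 : κ / N * supNorm (x - y) ≤ κ / N * ((N : ℝ) * supNorm (blkN N x - blkN N y) + ((N : ℝ) - 1)) :=
    mul_le_mul_of_nonneg_left hs (div_nonneg hκ hN0.le)
  have h2 : κ / N * ((N : ℝ) * supNorm (blkN N x - blkN N y) + ((N : ℝ) - 1))
      = κ * supNorm (blkN N x - blkN N y) + κ * (((N : ℝ) - 1) / N) := by field_simp
  have h3 : κ * (((N : ℝ) - 1) / N) ≤ κ := mul_le_of_le_one_right hκ (by rw [div_le_one hN0]; linarith)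
  linarith

/-- [our object] the column-difference letter in FINE-DISTANCE currency:
`‖piC N (x+e_μ) y − piC N x y‖ ≤ CS(D)·e^{κ_Y}·N^{−D}·(33∕N)·e^{−(κ_Y∕N)‖x−y‖∞}`. -/
theorem norm_piC_sub_right_le_fine (x y : Fin (d + 1) → ℤ) (μ : Fin (d + 1)) :
    ‖piC N (x + unitVec μ) y - piC N x y‖
      ≤ CS d * Real.exp (kapY (d + 1)) * ((N : ℝ) ^ (d + 1))⁻¹ * (33 / N) * Real.exp (-(kapY (d + 1) / N) * supNorm (x - y)) := by
  have hκ := (kapY_pos (d + 1)).le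
  have hCS : 0 ≤ CS d := by have := cN_pos d; unfold CS; positivity
  refine (norm_piC_sub_right_le N x y μ).trans ?_
  calc CS d * ((N : ℝ) ^ (d + 1))⁻¹ * (33 / N) * Real.exp (-(kapY (d + 1) * supNorm (blkN N x - blkN N y)))
      ≤ CS d * ((N : ℝ) ^ (d + 1))⁻¹ * (33 / N) * (Real.exp (kapY (d + 1)) * Real.exp (-(kapY (d + 1) / N) * supNorm (x - y))) :=
        mul_le_mul_of_nonneg_left (exp_blk_le_exp_fine N hκ x y) (by positivity)
    _ = _ := by ring

/-- [our object] the row-difference letter in fine-distance currency. -/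
theorem norm_piC_sub_left_le_fine (x y : Fin (d + 1) → ℤ) (ν : Fin (d + 1)) :
    ‖piC N x (y + unitVec ν) - piC N x y‖
      ≤ CS d * Real.exp (kapY (d + 1)) * ((N : ℝ) ^ (d + 1))⁻¹ * (33 / N) * Real.exp (-(kapY (d + 1) / N) * supNorm (x - y)) := by
  have hκ := (kapY_pos (d + 1)).le
  have hCS : 0 ≤ CS d := by have := cN_pos d; unfold CS; positivity
  refine (norm_piC_sub_left_le N x y ν).trans ?_
  calc CS d * ((N : ℝ) ^ (d + 1))⁻¹ * (33 / N) * Real.exp (-(kapY (d + 1) * supNorm (blkN N x - blkN N y)))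
      ≤ CS d * ((N : ℝ) ^ (d + 1))⁻¹ * (33 / N) * (Real.exp (kapY (d + 1)) * Real.exp (-(kapY (d + 1) / N) * supNorm (x - y))) :=
        mul_le_mul_of_nonneg_left (exp_blk_le_exp_fine N hκ x y) (by positivity)
    _ = _ := by ring

/-- [our object] the mixed second-difference letter in fine-distance currency. -/
theorem norm_piC_sub_sub_le_fine (x y : Fin (d + 1) → ℤ) (μ ν : Fin (d + 1)) :
    ‖piC N (x + unitVec μ) (y + unitVec ν) - piC N (x + unitVec μ) y - piC N x (y + unitVec ν) + piC N x y‖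
      ≤ CS d * Real.exp (kapY (d + 1)) * ((N : ℝ) ^ (d + 1))⁻¹ * (33 / N) ^ 2 * Real.exp (-(kapY (d + 1) / N) * supNorm (x - y)) := by
  have hκ := (kapY_pos (d + 1)).le
  have hCS : 0 ≤ CS d := by have := cN_pos d; unfold CS; positivity
  refine (norm_piC_sub_sub_le N x y μ ν).trans ?_
  calc CS d * ((N : ℝ) ^ (d + 1))⁻¹ * (33 / N) ^ 2 * Real.exp (-(kapY (d + 1) * supNorm (blkN N x - blkN N y)))
      ≤ CS d * ((N : ℝ) ^ (d + 1))⁻¹ * (33 / N) ^ 2 * (Real.exp (kapY (d + 1)) * Real.exp (-(kapY (d + 1) / N) * supNorm (x - y))) :=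
        mul_le_mul_of_nonneg_left (exp_blk_le_exp_fine N hκ x y) (by positivity)
    _ = _ := by ring

end Letters

end Summit.QuantumFields.BalabanUV.Beta.FP.SliceProjectorKernelDiff

end
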